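import Literature.MathematicalPhysics.QuantumFieldTheory.Balaban1983to89.B8SockHFPTraceFreePer
import Literature.MathematicalPhysics.QuantumFieldTheory.Balaban1983to89.B8Prop5KLevelLetters
import Literature.MathematicalPhysics.QuantumFieldTheory.Balaban1983to89.B8LeafModelZd3P
import Literature.MathematicalPhysics.QuantumFieldTheory.Balaban1983to89.B8PeriodicMemberGeometry
import Literature.MathematicalPhysics.QuantumFieldTheory.Balaban1983to89.B8LeafModelZd3SockPer
import Literature.MathematicalPhysics.QuantumFieldTheory.Balaban1983to89.B8Thm2TorusServerPer

/-!
# `Balaban1983to89.B8Prop5NestedServerPerBody` — [Balaban1985RegularSpaces] Proposition 5 (p. 94), EXISTENCE clauses (1.107)–(1.108), ON THE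
# TORUS READ ON `ℤᵈ` (p. 77 «Ω_j ⊂ T_η»: NESTED `P`-periodic domains `Ω₀ ⊃ Ω₁ ⊃ … ⊃ Ω_k`), AT ONE MEMBER AND ONE DATUM: the support-form ∃-clauses of
# pub-ymgap's guarded sockets `SP5base` ∕ `SP5` (T5 `B8Thm4CoreZdGF3HP2PerLanEGamma` :117–:149, instance (i) ZERO SOURCE: `LanF := IsLandau138W`) from the
# nested-Ω periodic ∃λ-storeys `B8SockHFPTraceFreePer` (`λ` periodic BY CONSTRUCTION) — sub-row «B8-P5-NESTED-SERVER», existence half, FILE 1 of 2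

statement-level skeleton of published theorems with citation tags; proofs where landed; nothing here is a claim about the
Yang–Mills mass gap

T. Bałaban, *Spaces of regular gauge field configurations on a lattice and gauge fixing conditions*, Commun. Math. Phys. **99** (1985) 75–102
`[Balaban1985RegularSpaces]` ("B8"; printed page = PDF page + 74): Prop. 5 (1.107)–(1.109) p. 94, Thm 4 p. 88, (1.68)–(1.69) p. 88, p. 89 («We will use only the
properties (1.69), (1.73), (1.74) … They are satisfied in the case k = 1 also, if we take u₁ = 1, U′ = U₁»), (1.86)–(1.88) p. 91, (1.38) p. 82, (1.29) p. 81,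
(1.66) p. 88, (1.3)–(1.5) p. 77 («Let us notice that we admit the case where some domains Ω_j are equal to T_η»).  T. Bałaban, *Propagators for lattice
gauge theories in a background field*, Commun. Math. Phys. **99** (1985) 389–434 `[Balaban1985BackgroundPropagators]` ("[4]"): Thm 3.1 p. 397, Thm 3.3 p. 399,
(3.19) p. 393.  STATUS: published, refereed.

PRINT, p. 94 (verbatim): «Proposition 5. There exist positive constants c₂, c₃, depending on d and L only, such that for an arbitrary configuration U₁
satisfying (1.69), and for the configuration u₁ determined by U₁ and satisfying (1.68), (1.73), (1.74), if α₀ + α₁ ≦ c₂, then there exists a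
configuration u′ = e^{iλ} satisfying the equations R D* (1∕iη) log U₁^{u′⁻¹} = 0, \overline{R₀u′u₁}ʲ = 1 on Λ_j, j = 0, 1, …, k (1.107) and the bounds
|λ|, |Dλ|₍₋₁₎ < 8B′₀B₁(α₀ + α₁). (1.108)»

CITATION HEADER (lean-in-tree rule).  Cell `lit-balaban`, seat `lit-balaban-r05` (gen 96; [B8] block owner), sub-row «B8-P5-NESTED-SERVER» (existence half:
S-base + S-step), commissioned by lead g33's WAKE `lit-balaban-r05/WAKE-B8P5NestedServerExist.md` (2026-08-28T18:12Z) on pub-ymgap dag-n05-c g17's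
INTERFACE REQUEST (pub-ymgap INBOX l.41793, 17:56:12Z).  `--supports stmt-QuantumFields-19200` (cell row; the consumer's bricks bear on 27364).

WHY THIS FILE.  pub-ymgap's brick T5 (`B8Thm4CoreZdGF3HP2PerLanEGamma.thm4Core_zdGF3HP₂Per_map_lanE_γ'`, p653438) displays Proposition 5's EXISTENCE
statement at nested `P`-periodic members `ι a : ZdIdx d L` as two guarded sockets — `SP5base` (level `1` from the datum `u₁ = 1`, `U₁ = U′`, p. 89) and `SP5`
(level `m + 1` from a PERIODIC level-`m` datum `(u₁, U₁ = e^{iηA}, A)`), asking for a unitary PERIODIC `v = e^{iλ}`, `= 1` off `Ω₀`, reading `e^{iλ}` on the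
bonds of the plaquettes touching `Ω_j`, with (1.108) graded «on Ω_j» at the radius `8B₀′(5dLB₈)(α₀ + α₁)` (`B₁ := 5dL·B₈`), the Landau condition of record
(1.38) for `U₁^{v⁻¹}` and (1.29) for `u₁·v` at `m + 1` levels.  The lit-balaban tree already holds, one storey below t2s-1's all-torus template
(`B8SockHFPTorusTraceFreePer` → `B8Thm2TorusServerPer`), the NESTED-Ω-generic PERIODIC ∃λ-storeys `B8SockHFPTraceFreePer.sockHFP_body_of_join_RD_traceFree_per`
(step) ∕ `sockHFP₀_body_of_join_RD_traceFree_per` (base): from the [4] letters at `(m + 1, U₀)` with (E1), (E2), (1.91) asked at periodic arguments only and the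
periodicity-preservation laws (P), the Proposition-5 contraction is run on the closed subspace of `P`-periodic configurations (`B8Prop5ContractionKLevelPer`),
so `λ` is Hermitian, `= 0` off `Ω₀`, obeys (1.108), solves the multiplier form of (1.107) and IS PERIODIC BY CONSTRUCTION; and pub-ymgap dag-n04-b's
`B8Prop5KLevelLetters.hP5_step_of_HFP` ∕ `hP5base_of_HFP` turn such a plain-currency fixed point into the support form (the ℤᵈ road, no periodicity).  THIS FILE
composes the two AT ONE MEMBER AND ONE DATUM, with the J-SU ∕ trace-free apparatus of the storeys COLLAPSED (T5's sockets are `U(𝔸)`-valued: `τ := 0`, `H := ⊤`,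
`G := U(𝔸)`, averaging-closed by `B7Prop2Explicit.avgClosed_unitaryUnits`): FILE 2 (`B8Prop5NestedServerPer`) packages the results into T5's binder texts verbatim.

WHAT THIS FILE PROVES (0 sorry, no `def`, no `… : Prop` fact, no `instance`, no `notation`):
* §0 period dictionary — `per_dir_of_isPeriodic` (pub-ymgap's full-lattice `T4TermwiseTorus.IsPeriodic (P : ℕ)` ⟹ the engines' per-direction form
  `F (z + (P : ℤ) • e i) = F z`; the converse is dag-n06-b's `B8LeafModelZd3SockPer.isPeriodic_of_forall_shift_e`), `gaugeExp_isPeriodic` (`e^{iλ}` of a periodic `λ`,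
  t2s-1's `B8Thm2TorusServerPer.gaugeExp_per` by name).
* §1 ★ `sP5_step_of_HFP_per` — `B8Prop5KLevelLetters.hP5_step_of_HFP` VERBATIM with the periodicity rider: from a fixed point `λ` in plain currency that is also
  `P`-periodic, the support-form ∃-clause of `SP5` at level `m + 1` WITH `IsPeriodic P v` (`v := e^{iλ}`); ★ `sP5base_of_HFP_per` — the same at the base
  (`u₁ = 1`, `U₁ = U′`; the datum `A₀ := (iη)⁻¹ log U′` by `B8Thm4TruncationLocal.base_datum`, periodic since `U′` is).
* §2 ★★ `sP5_body_of_join_per` — THE ∃-CLAUSE OF T5's `SP5` AT ONE MEMBER `(η, k, Ω, Λs, Λb)`, ONE PERIODIC UNITARY PAIR `(U₀, U′)` in Theorem 4's regime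
  ((1.33), (1.34), all-truncation axial, the (1.35)-closeness in the end-block form of `B8LeafModelZd3P.EndBlockIn`, the (1.66)₀ side clause) AND ONE PERIODIC LEVEL-`m`
  DATUM, from: the member laws (nesting, class bonds `hbox ∕ hclass`, towers at `m + 1`, the truncation relations `hlt ∕ htop`), the torus data (`Lʲ ∣ P`, `Λ_j`
  shift-invariant, `Ω_j` periodic), the b9 socket `B8LeafModelZd3.SockB9P3` at level `m` and the [4] LETTERS at `(m + 1, U₀)` DISPLAYED EXACTLY AS THE STOREY READS
  THEM (below), and the JOIN's scalar windows one-for-one at `c⋆ = 5dLB₈(α₀ + α₁)`, `α₄ = 8B₀′(5dLB₈)(α₀ + α₁)`.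
* §3 ★★ `sP5base_body_of_join_per` — THE ∃-CLAUSE OF T5's `SP5base` likewise (base storey; `k ≥ 1`, towers at level `1`).

THE [4] LETTERS AT NESTED `Ω_j` = DISPLAYED HYPOTHESES (dag-n05-c asked for this list; pub-ymgap node N06's periodic Green's-function line serves them; the
all-torus versions are the fields of `B8Thm2TorusLettersPer.LettersAtPer` :89).  Linear maps `g Δ : (Site d → 𝔸) →ₗ (Site d → 𝔸)` (`G′(U₀)` of (1.95) and `Δ↾Ω₀`),
`q : (Site d → 𝔸) →ₗ (ℕ → Site d → 𝔸)` (`Q′(U₀)`, [4] (3.19)), `qs : (ℕ → Site d → 𝔸) →ₗ (Site d → 𝔸)` (`Q′(U₀)ᵀ𝔄`), `Aw c : (ℕ → Site d → 𝔸) →ₗ (ℕ → Site d → 𝔸)`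
(the weights `𝔄` and `C` of (1.96)–(1.97)), `H′ : XSpace d (m+1) 𝔸 →ₗ (Site d → 𝔸)` ((1.91)–(1.92)), with: (E1) `g_rightΩ` — `(Δ(G′x) + Q′ᵀ𝔄Q′(G′x))(y) = x(y)` for
`y ∈ Ω₀` AT PERIODIC `x`; (E2) `c_range` — `Q′G′G′Q′ᵀC(Q′f) = Q′f` AT PERIODIC `f`; the readings `hΔ` (`Δ f = Δ_{U₀}(𝟙_{Ω₀}f)` on `Ω₀`), `hqs` (`qs μ = Q′(U₀)ᵀμ` on
`Ω₀` over `Λs (m+1)`), `hq` (`q f j = Q′_j(U₀) f` on `Λ_j`); the `H′` laws `hH0` (sup bound `B₀′H`), `hH1` (weighted gradient bound on the bonds of the plaquettes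
touching `Ω_j`), `hH2` (`Bd2` bound `B₂′` on `ΔH′`), `hHsupp` (`H′X = 0` off `Ω₀`), `hHequiv` (`H′(−X*) = −(H′X)*`), (P6) `hHper` (`H′` maps level-periodic families
to periodic functions), (1.91) `hQH` (`Q′_j H′Y = Y_j` on `Λ_j`) AT LEVEL-PERIODIC `Y`; the `G′` laws `hG` (sup + weighted-gradient bounds `BG·r` from a `Bd2`
bound `r`), `hGsupp`, `hGreal`; the remainder laws `hRbd` (`Bd2` bound `B_R·r` of `f − G′Q′ᵀCQ′G′f`), `hRreal`; (P) `hGper` (`G′` periodic-valued), `hqcq_per`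
(`Q′ᵀCQ′` maps periodic to periodic).  NONE of these is served at nested `Ω_j` in lit-balaban today.

HONEST SCOPE.  Compositions of landed theorems BY NAME; Proposition 5 (the contraction), Sect. E, [4] Thms 3.1 ∕ 3.3, [3] Prop. 10 are NOT re-proved — the
letters, the b9 socket and the windows are displayed hypotheses; `≤` where print has `<` in (1.108) (T5's currency); a server does NOT discharge N05;
count-neutral; `T_η` read as `P`-periodic data on `ηℤᵈ`; one finite `T⁴` programme at fixed `ε` — nothing continuum ∕ ℝ⁴ ∕ OS ∕ mass-gap ∕ Clay: the
Yang–Mills mass gap is NOT proved here or by anything this file feeds.  No `sorry`, no `def`, no `instance`, no `notation`.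
-/

noncomputable section

open NormedSpace
open scoped BigOperators
open Complex (I)

namespace Literature.MathematicalPhysics.QuantumFieldTheory.Balaban1983to89.B8Prop5NestedServerPerBody

open MatrixLog (mlog)
open B7Prop1Explicit B7Prop2Explicit B7Prop1Local B7Eq92Concrete
open B7Prop2Explicit (C0 c2' avgClosed_unitaryUnits)
open B7Prop3Flat (c3)
open B7Prop10General (C6 C4G)
open B7Prop9Flat (C5')
open B7Eq78Linearization (conjR zdBlocking QprimeIter)
open B8Ineq130 (tlo thi)
open B8Ineq132 (covDerivFwd covDeriv InAk BondTouches)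
open B8Eq119TwistedAxial (Restr129 InAx bgT)
open B8Eq184Proof (gaugeExp cfgExp)
open B8Eq182Proof (gAd)
open B8Eq188Proof (frakF3)
open B8Lemma1NonAbelian (mulCfg)
open B8Eq140Level (SideTouches)
open B8Thm2LogB (blockTop)
open B8Eq138LandauZd (IsLandau138W covDivB covLap QT)
open B8Ineq125Concrete (C2p)
open B8Eq1117Concrete (XSpace)
open B8Prop5ContractionKLevel (Bd2 Mc Kc)
open B8LambdaSpaceKLevel (wt)
open B8LeafModelZd3 (SockB9P3)
open B8LeafModelZd3P (EndBlockIn endBlockIn_of_box)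
open B8Prop5KLevelLetters (isLandau138W_gaugeFixed_of_multiplier)
open B8Thm4TruncationLocal (base_datum)
open B8SockHFPTraceFreePer (sockHFP_body_of_join_RD_traceFree_per sockHFP₀_body_of_join_RD_traceFree_per)
open B8PeriodicMemberGeometry (sideTouches_add_zsmul_iff)
open T4TermwiseTorus (IsPeriodic)
open B8LeafModelZd3SockPer (isPeriodic_of_forall_shift_e)
open B8Thm2TorusServerPer (gaugeExp_per)
open QuantumLattice (blockSites)

-- `Site` alone could resolve to the torus sites of `Setup.lean`; re-export the `ℤ^d` sites of `B7Prop1Explicit`.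
export B7Prop1Explicit (Site)

variable {d : ℕ}

/-! ## §0 Period dictionary: pub-ymgap's full-lattice `IsPeriodic (P : ℕ)` versus the engines' per-direction `z + (P : ℤ) • e i` -/

section Dictionary

/-- A `P`-periodic function (full lattice form, `F (x + P·m) = F x` for all `m ∈ ℤᵈ`) is periodic in every coordinate direction.
[cite: Balaban1985RegularSpaces, p.77 («Ω_j ⊂ T_η»); Balaban1985Averaging, (4) p.18] -/
theorem per_dir_of_isPeriodic {β : Sort*} {P : ℕ} {F : Site d → β} (h : IsPeriodic P F) :
    ∀ (z : Site d) (i : Fin d), F (z + (P : ℤ) • e i) = F z :=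
  fun z i => h z (e i)

variable {𝔸 : Type*} [CStarAlgebra 𝔸]

/-- `e^{iλ}` of a `λ` periodic in every direction is `P`-periodic in pub-ymgap's full-lattice sense (`B8Thm2TorusServerPer.gaugeExp_per` read through
`B8LeafModelZd3SockPer.isPeriodic_of_forall_shift_e`). [cite: Balaban1985RegularSpaces, Prop. 5 (1.107) p.94, p.77] -/
theorem gaugeExp_isPeriodic {P : ℕ} {lam : Site d → 𝔸} (h : ∀ (z : Site d) (i : Fin d), lam (z + (P : ℤ) • e i) = lam z) :
    IsPeriodic P (gaugeExp lam) :=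
  isPeriodic_of_forall_shift_e (gaugeExp_per h)

end Dictionary

/-! ## §1 The support-form ∃-clauses WITH the periodicity rider, from a periodic fixed point in plain currency
(`B8Prop5KLevelLetters.hP5_step_of_HFP` ∕ `hP5base_of_HFP` re-threaded; `v := e^{iλ}`) -/

section Adapters

/-- In `d ≥ 2` a bond with an end-point in `S` is a side of a plaquette touching `S` (p. 77 convention «b ∈ Ω»).
[cite: Balaban1985RegularSpaces, p.77 (convention before (1.5))] -/
private theorem sideTouches_of_bondTouches₂ (hd2 : 2 ≤ d) {S : Set (Site d)} {y : Site d} {τ : Fin d}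
    (hb : BondTouches S y τ) : SideTouches S y τ := by
  haveI : Nontrivial (Fin d) := Fin.nontrivial_iff_two_le.mpr hd2
  obtain ⟨κ, hκ⟩ := exists_ne τ
  exact B8Eq140Level.sideTouches_of_bondTouches hκ hb

variable {𝔸 : Type*} [CStarAlgebra 𝔸] [Nontrivial 𝔸]

/-- ★ **THE PROPOSITION-5 STEP IN PLAIN CURRENCY, PERIODIC, ⇒ THE SUPPORT-FORM ∃-CLAUSE OF `SP5` WITH THE RIDER `IsPeriodic P v`** (one level, any `m`;
`B8Prop5KLevelLetters.hP5_step_of_HFP` verbatim plus periodicity).  Given the level-`m` datum — `U₁ = e^{iηA}` on the bonds of the plaquettes touching `Ω_j`,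
`A` Hermitian, `|A| ≤ c⋆(Lʲη)⁻¹` — and a fixed point `λ` displayed in plain currency AND periodic in every direction (`λ(z + P e_i) = λ(z)`; the output of
`B8SockHFPTraceFreePer.sockHFP_body_of_join_RD_traceFree_per`, whose contraction runs on the periodic subspace): `λ` Hermitian, `= 0` off `Ω₀`, (1.108) at
the `m + 1` levels, the multiplier form of the Landau equation for the right-hand side of the D*-identity (1.86)–(1.88), (1.29) at `m + 1` levels for
`u₁·e^{iλ}` — the gauge transformation `v := e^{iλ}` is unitary (`B8Ineq170.exp_I_smul_mem_unitary`), `= 1` off `Ω₀`, reads `e^{iλ}` on every bond, obeys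
(1.108), `U₁^{v⁻¹}` satisfies the LANDAU CONDITION OF RECORD (1.38) at `m + 1` levels (`B8Prop5KLevelLetters.isLandau138W_gaugeFixed_of_multiplier`, the
smallness at the sites of `Ω₀` read off (1.108) and the datum at level `0`: `α₄ ≤ 1∕84`, `c⋆ ≤ 1∕12`), (1.29) holds for `u₁·v`, AND `v` IS `P`-PERIODIC
(`gaugeExp_isPeriodic`). [cite: Balaban1985RegularSpaces, Prop. 5 pp.93–94, (1.107)–(1.108) p.94, (1.86)–(1.88) p.91, (1.38) p.82, (1.29) p.81, p.77 («Ω_j ⊂ T_η»)] -/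
theorem sP5_step_of_HFP_per (hd2 : 2 ≤ d) {η : ℝ} (hη : 0 < η) (L m : ℕ) {P : ℕ} {U₀ : Site d → Fin d → 𝔸ˣ}
    (hU₀ : ∀ x κ, U₀ x κ ∈ unitaryUnits 𝔸) {cstar α₄ : ℝ} (hs₁ : α₄ ≤ 1 / 84) (hcs : cstar ≤ 1 / 12)
    (Ω : ℕ → Set (Site d)) (Λs : ℕ → ℕ → Set (Site d)) (u₁ : Site d → 𝔸ˣ) (U₁ : Site d → Fin d → 𝔸ˣ) (A : Site d → Fin d → 𝔸)
    (hdat : ∀ j, j ≤ m → ∀ b ∈ {b : Site d × Fin d | SideTouches (Ω j) b.1 b.2},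
      U₁ b.1 b.2 = cfgExp η A b.1 b.2 ∧ IsSelfAdjoint (A b.1 b.2) ∧ ‖A b.1 b.2‖ ≤ cstar * ((L : ℝ) ^ j * η)⁻¹)
    (hFP : ∃ lam : Site d → 𝔸, (∀ (z : Site d) (i : Fin d), lam (z + (P : ℤ) • e i) = lam z) ∧
      (∀ x, IsSelfAdjoint (lam x)) ∧ (∀ x, x ∉ Ω 0 → lam x = 0) ∧
      (∀ j, j ≤ m + 1 → ∀ b ∈ {b : Site d × Fin d | SideTouches (Ω j) b.1 b.2},
        ‖lam b.1‖ ≤ α₄ ∧ ((L : ℝ) ^ j * η) * ‖covDerivFwd η U₀ b.2 lam b.1‖ ≤ α₄) ∧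
      (∃ μ : ℕ → Site d → 𝔸, ∀ x ∈ Ω 0,
        covLap η U₀ ((Ω 0).indicator fun y => covDivB η U₀ A y + covLap η U₀ lam y +
          ((conjR (gaugeExp lam y)⁻¹ (covDivB η U₀ A y) - covDivB η U₀ A y) +
            (gAd (covLap η U₀ lam y) (lam y) - covLap η U₀ lam y) + ∑ μ, frakF3 η U₀ lam A y μ)) x =
          QT L (m + 1) (Λs (m + 1)) U₀ μ x) ∧
      Restr129 L (m + 1) (Λs (m + 1)) U₀ (u₁ * gaugeExp lam)) :
    ∃ (v : Site d → 𝔸ˣ) (lam : Site d → 𝔸), (∀ x, v x ∈ unitaryUnits 𝔸) ∧ (∀ x, x ∉ Ω 0 → v x = 1) ∧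
      (∀ j, j ≤ m + 1 → ∀ b ∈ {b : Site d × Fin d | SideTouches (Ω j) b.1 b.2}, (v b.1 : 𝔸) = ((gaugeExp lam b.1 : 𝔸ˣ) : 𝔸) ∧
        (v (b.1 + e b.2) : 𝔸) = ((gaugeExp lam (b.1 + e b.2) : 𝔸ˣ) : 𝔸)) ∧
      (∀ j, j ≤ m + 1 → ∀ b ∈ {b : Site d × Fin d | SideTouches (Ω j) b.1 b.2},
        ‖lam b.1‖ ≤ α₄ ∧ ((L : ℝ) ^ j * η) * ‖covDerivFwd η U₀ b.2 lam b.1‖ ≤ α₄) ∧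
      IsLandau138W L (m + 1) η (Ω 0) (Λs (m + 1)) U₀ (mgauge U₀ v⁻¹ U₁) ∧ Restr129 L (m + 1) (Λs (m + 1)) U₀ (u₁ * v) ∧
      IsPeriodic P v := by
  obtain ⟨lam, hlamP, hsa, hoff, h108, hmult, h129⟩ := hFP
  have hE0 : ∀ {y : Site d} {τ : Fin d}, BondTouches (Ω 0) y τ → (y, τ) ∈ {b : Site d × Fin d | SideTouches (Ω 0) b.1 b.2} :=
    fun hb => sideTouches_of_bondTouches₂ hd2 hb
  have hα12 : α₄ ≤ 1 / 12 := hs₁.trans (by norm_num)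
  have hα70 : α₄ ≤ 1 / 70 := hs₁.trans (by norm_num)
  have hd1 : 0 < d := by omega
  -- (1.108) at level `j = 0` on the bonds touching `Ω₀`
  have h0 : ∀ y τ, BondTouches (Ω 0) y τ → ‖lam y‖ ≤ α₄ ∧ η * ‖covDerivFwd η U₀ τ lam y‖ ≤ α₄ := fun y τ hb => by
    simpa only [pow_zero, one_mul] using h108 0 (Nat.zero_le _) (y, τ) (hE0 hb)
  have hl : ∀ x ∈ Ω 0, ‖lam x‖ ≤ 1 / 12 := fun x hx => (h0 x ⟨0, hd1⟩ (Or.inl hx)).1.trans hα12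
  have hD : ∀ x ∈ Ω 0, ∀ μ, η * ‖covDerivFwd η U₀ μ lam x‖ ≤ 1 / 70 := fun x hx μ => (h0 x μ (Or.inl hx)).2.trans hα70
  have hback : ∀ x ∈ Ω 0, ∀ μ : Fin d, BondTouches (Ω 0) (x - e μ) μ := fun x hx μ => Or.inr (by rwa [sub_add_cancel])
  have ha : ∀ x ∈ Ω 0, ∀ μ, η * ‖covDeriv η U₀ μ lam x‖ ≤ 1 / 70 := fun x hx μ => by
    rw [B8Eq151V2Divergence.norm_covDeriv_eq (unitaryUnits_le_U1 (hU₀ _ _)) lam]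
    exact (h0 _ μ (hback x hx μ)).2.trans hα70
  have hY : ∀ x ∈ Ω 0, ∀ μ, η * ‖conjR (U₀ (x - e μ) μ)⁻¹ (A (x - e μ) μ)‖ ≤ 1 / 12 := fun x hx μ => by
    obtain ⟨-, -, hA⟩ := hdat 0 (Nat.zero_le _) (x - e μ, μ) (hE0 (hback x hx μ))
    rw [B8Ineq132.norm_conjR ((U1 𝔸).inv_mem (unitaryUnits_le_U1 (hU₀ _ _)))]
    rw [pow_zero, one_mul] at hA
    calc η * ‖A (x - e μ) μ‖ ≤ η * (cstar * η⁻¹) := mul_le_mul_of_nonneg_left hA hη.le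
      _ = cstar := by rw [mul_left_comm, mul_inv_cancel₀ hη.ne', mul_one]
      _ ≤ 1 / 12 := hcs
  have hLan : IsLandau138W L (m + 1) η (Ω 0) (Λs (m + 1)) U₀ (mgauge U₀ (gaugeExp lam)⁻¹ (cfgExp η A)) :=
    isLandau138W_gaugeFixed_of_multiplier hη L (m + 1) (Ω 0) (Λs (m + 1)) U₀ A hl hD ha hY hmult
  have hcongr : ∀ (x : Site d) (μ : Fin d), BondTouches (Ω 0) x μ →
      mgauge U₀ (gaugeExp lam)⁻¹ U₁ x μ = mgauge U₀ (gaugeExp lam)⁻¹ (cfgExp η A) x μ := fun x μ hb => by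
    rw [mgauge_apply, mgauge_apply, (hdat 0 (Nat.zero_le _) (x, μ) (hE0 hb)).1]
  refine ⟨gaugeExp lam, lam, fun x => ?_, fun x hx => ?_, fun j _ b _ => ⟨rfl, rfl⟩, h108,
    (B8Eq138LandauZd.isLandau138W_congr η L U₀ hcongr).mpr hLan, h129, gaugeExp_isPeriodic hlamP⟩
  · exact mem_unitaryUnits.mpr (B8Ineq170.exp_I_smul_mem_unitary (hsa x))
  · exact Units.ext (by rw [gaugeExp, hoff x hx, smul_zero, val_expUnit, NormedSpace.exp_zero, Units.val_one])

/-- ★ **THE BASE (`u₁ = 1`, `U₁ = U′`, p. 89 «k = 1 also») IN PLAIN CURRENCY, PERIODIC, ⇒ THE SUPPORT-FORM ∃-CLAUSE OF `SP5base` WITH THE RIDER `IsPeriodic P v`**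
(`B8Prop5KLevelLetters.hP5base_of_HFP` verbatim plus periodicity): by the (1.66)₀ side clause `|U′ − 1| ≤ a ≤ 1∕4` on the bonds of the plaquettes touching `Ω₀`,
`U′ = e^{iηA₀}` there with `A₀ := (iη)⁻¹ log U′` Hermitian and `|A₀| ≤ 2aη⁻¹ ≤ c⋆η⁻¹` (`B8Thm4TruncationLocal.base_datum`) — the datum of level `0`, PERIODIC IN EVERY
DIRECTION BECAUSE `U′` IS — and the periodic plain-currency fixed point `HFP₀` for that datum gives the clause by `sP5_step_of_HFP_per` at `m = 0`.
[cite: Balaban1985RegularSpaces, Prop. 5 pp.93–94, (1.66) p.88, p.89, (1.107)–(1.108) p.94, p.77 («Ω_j ⊂ T_η»)] -/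
theorem sP5base_of_HFP_per (hd2 : 2 ≤ d) {η : ℝ} (hη : 0 < η) (L : ℕ) {P : ℕ} {U₀ U' : Site d → Fin d → 𝔸ˣ}
    (hU₀ : ∀ x κ, U₀ x κ ∈ unitaryUnits 𝔸) (hU' : ∀ x κ, U' x κ ∈ unitaryUnits 𝔸)
    (hU'p : ∀ (z : Site d) (i : Fin d), U' (z + (P : ℤ) • e i) = U' z)
    {cstar α₄ a : ℝ} (hs₁ : α₄ ≤ 1 / 84)
    (hcs : cstar ≤ 1 / 12) (ha : a ≤ 1 / 4) (ha2 : 2 * a ≤ cstar) (Ω : ℕ → Set (Site d)) (Λs : ℕ → ℕ → Set (Site d))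
    (h66 : ∀ b ∈ {b : Site d × Fin d | SideTouches (Ω 0) b.1 b.2}, ‖((U' b.1 b.2 : 𝔸ˣ) : 𝔸) - 1‖ ≤ a)
    (HFP₀ : ∀ A : Site d → Fin d → 𝔸, (∀ (z : Site d) (i : Fin d), A (z + (P : ℤ) • e i) = A z) →
      (∀ j, j ≤ 0 → ∀ b ∈ {b : Site d × Fin d | SideTouches (Ω j) b.1 b.2},
        U' b.1 b.2 = cfgExp η A b.1 b.2 ∧ IsSelfAdjoint (A b.1 b.2) ∧ ‖A b.1 b.2‖ ≤ cstar * ((L : ℝ) ^ j * η)⁻¹) →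
      ∃ lam : Site d → 𝔸, (∀ (z : Site d) (i : Fin d), lam (z + (P : ℤ) • e i) = lam z) ∧
        (∀ x, IsSelfAdjoint (lam x)) ∧ (∀ x, x ∉ Ω 0 → lam x = 0) ∧
        (∀ j, j ≤ 1 → ∀ b ∈ {b : Site d × Fin d | SideTouches (Ω j) b.1 b.2},
          ‖lam b.1‖ ≤ α₄ ∧ ((L : ℝ) ^ j * η) * ‖covDerivFwd η U₀ b.2 lam b.1‖ ≤ α₄) ∧
        (∃ μ : ℕ → Site d → 𝔸, ∀ x ∈ Ω 0,
          covLap η U₀ ((Ω 0).indicator fun y => covDivB η U₀ A y + covLap η U₀ lam y +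
            ((conjR (gaugeExp lam y)⁻¹ (covDivB η U₀ A y) - covDivB η U₀ A y) +
              (gAd (covLap η U₀ lam y) (lam y) - covLap η U₀ lam y) + ∑ μ, frakF3 η U₀ lam A y μ)) x =
            QT L 1 (Λs 1) U₀ μ x) ∧
        Restr129 L 1 (Λs 1) U₀ ((1 : Site d → 𝔸ˣ) * gaugeExp lam)) :
    ∃ (v : Site d → 𝔸ˣ) (lam : Site d → 𝔸), (∀ x, v x ∈ unitaryUnits 𝔸) ∧ (∀ x, x ∉ Ω 0 → v x = 1) ∧
      (∀ j, j ≤ 1 → ∀ b ∈ {b : Site d × Fin d | SideTouches (Ω j) b.1 b.2}, (v b.1 : 𝔸) = ((gaugeExp lam b.1 : 𝔸ˣ) : 𝔸) ∧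
        (v (b.1 + e b.2) : 𝔸) = ((gaugeExp lam (b.1 + e b.2) : 𝔸ˣ) : 𝔸)) ∧
      (∀ j, j ≤ 1 → ∀ b ∈ {b : Site d × Fin d | SideTouches (Ω j) b.1 b.2},
        ‖lam b.1‖ ≤ α₄ ∧ ((L : ℝ) ^ j * η) * ‖covDerivFwd η U₀ b.2 lam b.1‖ ≤ α₄) ∧
      IsLandau138W L 1 η (Ω 0) (Λs 1) U₀ (mgauge U₀ v⁻¹ U') ∧ Restr129 L 1 (Λs 1) U₀ ((1 : Site d → 𝔸ˣ) * v) ∧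
      IsPeriodic P v := by
  set A₀ : Site d → Fin d → 𝔸 := fun y μ => η⁻¹ • ((I⁻¹ : ℂ) • mlog ((U' y μ : 𝔸ˣ) : 𝔸))
  have hA₀p : ∀ (z : Site d) (i : Fin d), A₀ (z + (P : ℤ) • e i) = A₀ z := fun z i => by
    funext μ
    simp only [A₀, hU'p z i]
  have hdat : ∀ j, j ≤ 0 → ∀ b ∈ {b : Site d × Fin d | SideTouches (Ω j) b.1 b.2},
      U' b.1 b.2 = cfgExp η A₀ b.1 b.2 ∧ IsSelfAdjoint (A₀ b.1 b.2) ∧ ‖A₀ b.1 b.2‖ ≤ cstar * ((L : ℝ) ^ j * η)⁻¹ := by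
    intro j hj b hb
    obtain rfl : j = 0 := Nat.le_zero.mp hj
    obtain ⟨-, hexp, hsa, hn⟩ := base_datum hη U₀ U' hU' ha b.1 b.2 (h66 b hb)
    refine ⟨hexp, hsa, hn.trans ?_⟩
    rw [pow_zero, one_mul]
    exact mul_le_mul_of_nonneg_right ha2 (inv_nonneg.mpr hη.le)
  exact sP5_step_of_HFP_per hd2 hη L 0 hU₀ hs₁ hcs Ω Λs 1 U' A₀ hdat (HFP₀ A₀ hA₀p hdat)

end Adapters

/-! ## §2 T5's `SP5` ∃-clause at ONE member, ONE periodic pair and ONE periodic level-`m` datum, from the nested periodic ∃λ-storey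
(`B8SockHFPTraceFreePer.sockHFP_body_of_join_RD_traceFree_per` at `τ := 0`, `H := ⊤`, `G := U(𝔸)`) -/

section Step

variable {𝔸 : Type*} [CStarAlgebra 𝔸] [Nontrivial 𝔸]

/-- ★★ **PROPOSITION 5, EXISTENCE (1.107)–(1.108) AT LEVEL `m + 1`, NESTED PERIODIC DOMAINS — THE ∃-CLAUSE OF pub-ymgap's GUARDED SOCKET `SP5`
(T5 `B8Thm4CoreZdGF3HP2PerLanEGamma` :131–:149, `LanF := IsLandau138W`) AT ONE MEMBER, ONE PERIODIC UNITARY PAIR AND ONE PERIODIC LEVEL-`m` DATUM.**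
For `d, L ≥ 2`, a member `(η, k, Ω, Λs, Λb)` with its laws (nesting (1.3), the class bonds of the (1.42) lemma `hbox ∕ hclass`, towers «Bʲ(y) ⊂ Ω_j» at the
truncation `m + 1`, the truncation relations `hlt ∕ htop` between the level-`m` and level-`(m+1)` families), `1 ≤ m < k`, a unitary pair `(U₀, U′)` with `U₀`
`P`-periodic in Theorem 4's regime ((1.33), (1.34), all-truncation axial gauge, the (1.35)-closeness in the end-block form, read here only through
`B8LeafModelZd3P.endBlockIn_of_box`), a PERIODIC level-`m` datum `(u₁, U₁ = U′^{u₁⁻¹}, A)` ((1.29)_m, (1.38)_m, (1.69): `U₁ = e^{iηA}` Hermitian with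
`|A| ≤ c⋆(Lʲη)⁻¹` on the bonds of the plaquettes touching `Ω_j`, `j ≤ m`, `c⋆ = 5dLB₈(α₀ + α₁)`), the torus data (`Lʲ ∣ P`, `Λ_j^{(m+1)}` shift-invariant, `Ω_j`
`P`-periodic), the b9 socket of Proposition 3's frame at level `m` ([4] Thm 3.3, `B8LeafModelZd3.SockB9P3` at `B₈`), THE [4] LETTERS AT `(m + 1, U₀)` WITH THEIR
LAWS (E1) ∕ (E2) ∕ (1.91) AT PERIODIC ARGUMENTS AND (P) (module docstring), and the JOIN's scalar windows one-for-one at `α₄ = 8B₀′(5dLB₈)(α₀ + α₁)`: THERE ARE a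
unitary `P`-PERIODIC `v = e^{iλ}`, `= 1` off `Ω₀`, reading `e^{iλ}` on the bonds of the plaquettes touching `Ω_j` (`j ≤ m + 1`), with (1.108) graded «on Ω_j» at
`α₄`, the Landau condition of record (1.38) for `U₁^{v⁻¹}` and (1.29) for `u₁·v` at `m + 1` levels — i.e. the ∃-clause of `SP5` with `LanF := IsLandau138W`.
PROOF: the storey (J-SU collapsed to `U(𝔸)` by `B7Prop2Explicit.avgClosed_unitaryUnits`, `τ := 0`) gives the periodic plain-currency fixed point; `sP5_step_of_HFP_per`
converts it (`α₄ ≤ 1∕84` from the window `200·C₆·2α₄ ≤ 1`, `C₆ ≥ 2`; `c⋆ ≤ 1∕12` from `L·c⋆ ≤ c_B`, `40d·c_B ≤ 1∕200`).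
[cite: Balaban1985RegularSpaces, Prop. 5 (1.107)–(1.108) p.94, Thm 4 p.88, (1.68)–(1.69) p.88, (1.86)–(1.88) p.91, (1.113)–(1.121) pp.95–97, (1.38) p.82, (1.29) p.81, p.77 («Ω_j ⊂ T_η»); Balaban1985BackgroundPropagators, Thm 3.1 p.397, Thm 3.3 p.399, (3.19) p.393; Balaban1985Averaging, Prop. 10, (213) p.48] -/
theorem sP5_body_of_join_per (hd2 : 2 ≤ d) {L : ℕ} (hL : 2 ≤ L) {η : ℝ} (hη : 0 < η) (P : ℕ) {k : ℕ}
    -- the member's geometry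
    {Ω : ℕ → Set (Site d)} (hΩ : ∀ j, Ω (j + 1) ⊆ Ω j) {Λs : ℕ → ℕ → Set (Site d)} {Λb : ℕ → ℕ → Set (Site d × Fin d)}
    (hbox : ∀ m, m ≤ k → ∀ j, j ≤ m → ∀ c ∈ Λb m j, ∀ x, InBox (loK L j c.1) (bondHiK L j c.1 c.2) x → x ∈ Ω j)
    (hclass : ∀ m, m ≤ k → ∀ j, j ≤ m → ∀ c ∈ Λb m j,
      (c.1 ∈ Λs m j ∧ c.1 + e c.2 ∈ Λs m j) ∨
      (∃ j', j = j' + 1 ∧ (∀ x, (L : ℤ) • c.1 ≤ x → x ≤ (L : ℤ) • c.1 + blockTop L → x ∈ Λs m j') ∧ c.1 + e c.2 ∈ Λs m j) ∨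
      (∃ j', j = j' + 1 ∧ c.1 ∈ Λs m j ∧ (∀ x, (L : ℤ) • (c.1 + e c.2) ≤ x → x ≤ (L : ℤ) • (c.1 + e c.2) + blockTop L → x ∈ Λs m j')))
    {m : ℕ} (hm1 : 1 ≤ m) (hmk : m < k)
    (htower : ∀ j, j ≤ m + 1 → ∀ y ∈ Λs (m + 1) j, ∀ x, InBox (tlo L y j) (thi L y j) x → x ∈ Ω j)
    (hlt : ∀ j, j < m → Λs m j = Λs (m + 1) j)
    (htop : ∀ x, x ∈ Λs m m ↔ x ∈ Λs (m + 1) m ∨ ∃ y ∈ Λs (m + 1) (m + 1), x ∈ blockSites L y)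
    -- the socket's antecedents: constants, (1.33), (1.34), (1.35)/(1.66)
    {α₀ α₁ B₈ B₀' cs α₄ : ℝ} (hα₀ : 0 < α₀) (hα₁ : 0 < α₁) (hB₈ : 0 < B₈) (hB₀' : 0 < B₀')
    (hcs_def : cs = 5 * (d : ℝ) * L * B₈ * (α₀ + α₁)) (hα₄_def : α₄ = 8 * B₀' * (5 * (d : ℝ) * L * B₈) * (α₀ + α₁))
    {U₀ U' : Site d → Fin d → 𝔸ˣ} (hU₀ : ∀ x κ, U₀ x κ ∈ unitaryUnits 𝔸) (hU' : ∀ x κ, U' x κ ∈ unitaryUnits 𝔸) (hU₀p : IsPeriodic P U₀)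
    (h33 : InAk L k η α₀ Ω U₀) (h34 : InAk L k η α₀ Ω (mulCfg U' U₀)) (hAx : ∀ m', m' ≤ k → InAx L m' (Λs m') U₀ (mulCfg U' U₀))
    (h135 : ∀ j, j ≤ k → ∀ (z : Site d) (μ : Fin d),
      ((∀ x, InBox (tlo L z j) (thi L z j) x → x ∈ Ω j) ∨ (∀ x, InBox (tlo L (z + e μ) j) (thi L (z + e μ) j) x → x ∈ Ω j)) →
      ‖(avgIter L (mulCfg U' U₀) j z μ : 𝔸) - (avgIter L U₀ j z μ : 𝔸)‖ ≤ α₁)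
    -- the PERIODIC datum at level `m`
    {u₁ : Site d → 𝔸ˣ} {U₁ : Site d → Fin d → 𝔸ˣ} {A : Site d → Fin d → 𝔸}
    (hu₁ : ∀ x, u₁ x ∈ unitaryUnits 𝔸) (hu₁p : IsPeriodic P u₁) (hAp : IsPeriodic P A) (hW : mgauge U₀ u₁ U₁ = U') (h129 : Restr129 L m (Λs m) U₀ u₁)
    (hLan : IsLandau138W L m η (Ω 0) (Λs m) U₀ U₁)
    (hdat : ∀ j, j ≤ m → ∀ b ∈ {b : Site d × Fin d | SideTouches (Ω j) b.1 b.2},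
      U₁ b.1 b.2 = cfgExp η A b.1 b.2 ∧ IsSelfAdjoint (A b.1 b.2) ∧ ‖A b.1 b.2‖ ≤ cs * ((L : ℝ) ^ j * η)⁻¹)
    -- the b9 socket in Proposition 3's frame AT LEVEL `m`, and its threshold
    {B₀β cB9 β : ℝ} {len : Site d → ℝ} (SB9 : SockB9P3 (𝔸 := 𝔸) L B₈ B₀β cB9 β len η m Ω Λs Λb)
    (hα₀9 : α₀ ≤ cB9) (hcs9 : cs ≤ cB9)
    -- Proposition 3's windows at `(α₀, α₂ := c⋆)` not implied by the JOIN's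
    {C₂ : ℝ} (hside : 36 * d * B₈ * cs ≤ 1 / 2)
    (hC₂ : 8 * (131072 * ((d : ℝ) + 1) ^ 2) * Real.exp (4 * (800 * ((d : ℝ) + 1) ^ 2 * ((d : ℝ) + 4)) * α₀) ≤ C₂)
    (h61 : 2 * cs ^ 2 + 20 * d * α₀ * cs + 2 * C₂ * cs ^ 2 ≤ α₀ + α₁) (hsmall₁ : (d : ℝ) * L * α₁ ≤ 1 / 8)
    -- the [4] LETTERS at `(m + 1, U₀)`, displayed as the JOIN reads them
    (g Δ : (Site d → 𝔸) →ₗ[ℂ] (Site d → 𝔸)) (q : (Site d → 𝔸) →ₗ[ℂ] (ℕ → Site d → 𝔸)) (qs : (ℕ → Site d → 𝔸) →ₗ[ℂ] (Site d → 𝔸))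
    (Aw c : (ℕ → Site d → 𝔸) →ₗ[ℂ] (ℕ → Site d → 𝔸))
    (g_rightΩ : ∀ x, (∀ (z : Site d) (i : Fin d), x (z + (P : ℤ) • e i) = x z) → ∀ y ∈ Ω 0, (Δ (g x) + qs (Aw (q (g x)))) y = x y)
    (c_range : ∀ f, (∀ (z : Site d) (i : Fin d), f (z + (P : ℤ) • e i) = f z) → q (g (g (qs (c (q f))))) = q f)
    -- the torus: every `Lʲ ∣ P`, shift-invariant `Λ_j`, periodic `Ω_j`; periodicity-preserving `G′`, `Q′ᵀCQ′` ((P) laws)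
    (hdiv : ∀ j, j ≤ m + 1 → ((L : ℤ) ^ j ∣ (P : ℤ)))
    (hΛ : ∀ j, j ≤ m + 1 → ∀ (y : Site d) (i : Fin d), y + ((P : ℤ) / (L : ℤ) ^ j) • e i ∈ Λs (m + 1) j ↔ y ∈ Λs (m + 1) j)
    (hΩp : ∀ j, j ≤ m → IsPeriodic P (fun x : Site d => x ∈ Ω j))
    (hGper : ∀ (f : Site d → 𝔸) (z : Site d) (i : Fin d), g f (z + (P : ℤ) • e i) = g f z)
    (hqcq_per : ∀ f : Site d → 𝔸, (∀ (z : Site d) (i : Fin d), f (z + (P : ℤ) • e i) = f z) →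
      ∀ (z : Site d) (i : Fin d), qs (c (q f)) (z + (P : ℤ) • e i) = qs (c (q f)) z)
    (hΔ : ∀ (f : Site d → 𝔸), ∀ x ∈ Ω 0, Δ f x = covLap η U₀ ((Ω 0).indicator f) x)
    (hqs : ∀ (μ : ℕ → Site d → 𝔸), ∀ x ∈ Ω 0, qs μ x = QT L (m + 1) (Λs (m + 1)) U₀ μ x)
    (hq : ∀ (f : Site d → 𝔸) (j : ℕ), j ≤ m + 1 → ∀ y ∈ Λs (m + 1) j, q f j y = QprimeIter (zdBlocking d L) (bgT L U₀) j f y)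
    (H' : XSpace d (m + 1) 𝔸 →ₗ[ℂ] (Site d → 𝔸)) {B₀'H B₂' BG BR : ℝ} (hB₀'H : 0 < B₀'H) (hB₂' : 0 ≤ B₂') (hBG : 0 ≤ BG) (hBR : 0 ≤ BR)
    (hH0 : ∀ (X : XSpace d (m + 1) 𝔸) (x : Site d), ‖H' X x‖ ≤ B₀'H * ‖X‖)
    (hH1 : ∀ j, j ≤ m + 1 → ∀ (X : XSpace d (m + 1) 𝔸), ∀ p ∈ {b : Site d × Fin d | SideTouches (Ω j) b.1 b.2},
      wt L η j * ‖covDerivFwd η U₀ p.2 (H' X) p.1‖ ≤ B₀'H * ‖X‖)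
    (hH2 : ∀ X : XSpace d (m + 1) 𝔸, Bd2 L η (m + 1) Ω (covLap η U₀ (H' X)) (B₂' * ‖X‖))
    (hHsupp : ∀ (X : XSpace d (m + 1) 𝔸) (x : Site d), x ∉ Ω 0 → H' X x = 0)
    (hHequiv : ∀ X Y : XSpace d (m + 1) 𝔸, (∀ p, Y p = -star (X p)) → ∀ x, H' Y x = -star (H' X x))
    (hHper : ∀ X : XSpace d (m + 1) 𝔸, (∀ (p : Fin (m + 1 + 1) × Site d) (i : Fin d), X (p.1, p.2 + ((P : ℤ) / (L : ℤ) ^ (p.1 : ℕ)) • e i) = X p) →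
      ∀ (z : Site d) (i : Fin d), H' X (z + (P : ℤ) • e i) = H' X z)
    (hQH : ∀ (Y : XSpace d (m + 1) 𝔸), (∀ (p : Fin (m + 1 + 1) × Site d) (i : Fin d), Y (p.1, p.2 + ((P : ℤ) / (L : ℤ) ^ (p.1 : ℕ)) • e i) = Y p) →
      ∀ (j : ℕ) (hj : j ≤ m + 1) (y : Site d), y ∈ Λs (m + 1) j →
      QprimeIter (zdBlocking d L) (bgT L U₀) j (H' Y) y = Y (⟨j, Nat.lt_succ_of_le hj⟩, y))
    (hG : ∀ (f : Site d → 𝔸) (r : ℝ), 0 ≤ r → Bd2 L η (m + 1) Ω f r →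
      (∀ x, ‖g f x‖ ≤ BG * r) ∧ ∀ j, j ≤ m + 1 → ∀ p ∈ {b : Site d × Fin d | SideTouches (Ω j) b.1 b.2},
        wt L η j * ‖covDerivFwd η U₀ p.2 (g f) p.1‖ ≤ BG * r)
    (hGsupp : ∀ (f : Site d → 𝔸) (x : Site d), x ∉ Ω 0 → g f x = 0)
    (hGreal : ∀ f : Site d → 𝔸, (∀ j, j ≤ m + 1 → ∀ x ∈ Ω j, IsSelfAdjoint (f x)) → ∀ x, IsSelfAdjoint (g f x))
    (hRbd : ∀ (f : Site d → 𝔸) (r : ℝ), 0 ≤ r → Bd2 L η (m + 1) Ω f r → Bd2 L η (m + 1) Ω (f - g (qs (c (q (g f))))) (BR * r))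
    (hRreal : ∀ f : Site d → 𝔸, (∀ j, j ≤ m + 1 → ∀ x ∈ Ω j, IsSelfAdjoint (f x)) →
      ∀ j, j ≤ m + 1 → ∀ x ∈ Ω j, IsSelfAdjoint ((f - g (qs (c (q (g f))))) x))
    -- the JOIN's scalar windows, one-for-one (`αP := α₀`, `α₄ := 8B₀′c⋆`; `cB cA cDA` free above their datum values)
    {cB cA cDA : ℝ} (hcBlo : L * cs ≤ cB) (hcAlo : L * cs ≤ cA) (hcDAlo : (d : ℝ) * (L : ℝ) ^ 2 * cs ≤ cDA)
    (hα3 : C0 d * α₀ ≤ 1 / 3) (hα4 : 4 * α₀ ≤ c2' d L)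
    (hsmall : Real.exp (4 * (800 * ((d : ℝ) + 1) ^ 2 * ((d : ℝ) + 4)) * α₀) * (1 + 8 * (131072 * ((d : ℝ) + 1) ^ 2) * cB) ≤ 2)
    (hc₃ : 2 * cB ≤ c3 d L) (hsc : 2048 * (d : ℝ) * cB ≤ 1) (hα₃' : 40 * d * cB ≤ 1 / 200)
    (hs₁ : 200 * C6 d * (2 * α₄) ≤ 1) (hs₂ : 12000 * ((d : ℝ) + 1) * L * (2 * α₄) ≤ 1)
    (hs₃ : C4G d L * (α₀ + 40 * d * cB + 4 * (2 * α₄)) ≤ 1)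
    (hs₄ : 1024 * ((d : ℝ) + 1) * ((d : ℝ) + 4) * L ^ 2 * α₀ ≤ 1) (hs₅ : 32 * ((d : ℝ) + 1) ^ 2 * C6 d * L ^ 2 * α₀ ≤ 1)
    (hs₆ : 16 * d * C5' d * C6 d * (L : ℝ) ^ 2 * α₀ ≤ 1) (hs₇ : 8 * d * C6 d * L * α₀ ≤ 1)
    (hsm : 40 * d * cB + α₄ ≤ 1 / (4 * B₀'H * (2 * C2p d))) (hprod8 : 2 * C6 d * (40 * d * cB + 4 * α₄) ≤ 1 / 8)
    {hE hE₂ lE lE₂ : ℝ} (hE_def : hE = B₀'H * (C2p d * (40 * d * cB + α₄) * α₄)) (hE₂_def : hE₂ = B₂' * (C2p d * (40 * d * cB + α₄) * α₄))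
    (lE_def : lE = B₀'H * (4 * C2p d * (40 * d * cB + 2 * α₄))) (lE₂_def : lE₂ = B₂' * (4 * C2p d * (40 * d * cB + 2 * α₄)))
    (hcA' : cA ≤ 1 / 13) (ha₁' : α₄ / 4 + hE ≤ 1 / 24) (hb₁' : α₄ / 4 + hE ≤ 1 / 140) (hθ : 10 * (α₄ / 4 + hE) * BR ≤ 1 / 2)
    (h103 : BG * Mc d BR (α₄ / 4 + hE) cA hE₂ cDA ≤ α₄ / 4)
    (h106 : BG * Kc d BR (α₄ / 4 + hE) cA hE₂ cDA lE₂ (1 + lE) (1 + lE) ≤ 1 / 2) :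
    ∃ (v : Site d → 𝔸ˣ) (lam : Site d → 𝔸), (∀ x, v x ∈ unitaryUnits 𝔸) ∧ (∀ x, x ∉ Ω 0 → v x = 1) ∧
      (∀ j, j ≤ m + 1 → ∀ b ∈ {b : Site d × Fin d | SideTouches (Ω j) b.1 b.2}, (v b.1 : 𝔸) = ((gaugeExp lam b.1 : 𝔸ˣ) : 𝔸) ∧
        (v (b.1 + e b.2) : 𝔸) = ((gaugeExp lam (b.1 + e b.2) : 𝔸ˣ) : 𝔸)) ∧
      (∀ j, j ≤ m + 1 → ∀ b ∈ {b : Site d × Fin d | SideTouches (Ω j) b.1 b.2},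
        ‖lam b.1‖ ≤ (8 * B₀' * (5 * (d : ℝ) * L * B₈) * (α₀ + α₁)) ∧
          ((L : ℝ) ^ j * η) * ‖covDerivFwd η U₀ b.2 lam b.1‖ ≤ (8 * B₀' * (5 * (d : ℝ) * L * B₈) * (α₀ + α₁))) ∧
      IsLandau138W L (m + 1) η (Ω 0) (Λs (m + 1)) U₀ (mgauge U₀ v⁻¹ U₁) ∧ Restr129 L (m + 1) (Λs (m + 1)) U₀ (u₁ * v) ∧
      IsPeriodic P v := by
  -- two of the windows in the adapter's currency: `α₄ ≤ 1/84` (from `hs₁`, `C₆ ≥ 2`) and `c⋆ ≤ 1/12` (from `hcBlo`, `hα₃'`)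
  have hsum : 0 ≤ α₀ + α₁ := by linarith
  have hcs0 : 0 ≤ cs := by rw [hcs_def]; positivity
  have hα₄0 : 0 ≤ α₄ := by rw [hα₄_def]; positivity
  have hC6 : (2 : ℝ) ≤ C6 d := by unfold C6; linarith [B7Prop10Flat.one_le_C5 (d := d)]
  have hα84 : α₄ ≤ 1 / 84 := by
    have h1 : 400 * (C6 d * α₄) ≤ 1 := by linarith only [hs₁]
    have h2 : 2 * α₄ ≤ C6 d * α₄ := mul_le_mul_of_nonneg_right hC6 hα₄0
    linarith only [h1, h2]
  have hd1 : (1 : ℝ) ≤ d := by exact_mod_cast (show 1 ≤ d by omega)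
  have hL1 : (1 : ℝ) ≤ L := by exact_mod_cast (show 1 ≤ L by omega)
  have hcs12 : cs ≤ 1 / 12 := by
    have h1 : cs ≤ L * cs := le_mul_of_one_le_left hcs0 hL1
    have h2 : L * cs ≤ cB := hcBlo
    have h3 : cB ≤ (d : ℝ) * cB := le_mul_of_one_le_left (hcs0.trans (h1.trans h2)) hd1
    have h4 : 40 * ((d : ℝ) * cB) ≤ 1 / 200 := by linarith only [hα₃']
    linarith only [h1, h2, h3, h4]
  have hbody := sockHFP_body_of_join_RD_traceFree_per (0 : 𝔸 →L[ℂ] ℂ) (fun _ _ => by simp) hd2 hL hη (P : ℤ)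
    (G := unitaryUnits 𝔸) (H := ⊤) (fun _ _ _ => by simp) (fun _ _ => Subgroup.mem_top _) (avgClosed_unitaryUnits d L) le_top le_rfl
    hΩ hbox hclass hm1 hmk htower hlt htop hα₀ hα₁ hB₈ hB₀' hcs_def hα₄_def hU₀ hU' h33 h34 hAx
    (fun j hj z μ hb => h135 j hj z μ (endBlockIn_of_box L (Ω j) j z μ hb))
    hu₁ (fun _ => Subgroup.mem_top _) hW h129 hLan hdat (fun _ _ _ _ => by simp) SB9 hα₀9 hcs9 hside hC₂ h61 hsmall₁
    g Δ q qs Aw c g_rightΩ c_range hdiv hΛ (fun j hj x κ i => sideTouches_add_zsmul_iff (hΩp j hj) x (e i) κ)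
    (per_dir_of_isPeriodic hU₀p) (per_dir_of_isPeriodic hAp) (per_dir_of_isPeriodic hu₁p) hGper hqcq_per hΔ hqs hq H' hB₀'H hB₂' hBG hBR
    hH0 hH1 hH2 hHsupp hHequiv hHper hQH hG hGsupp hGreal hRbd hRreal
    (fun _ _ _ => by simp) (fun _ _ _ => by simp) (fun _ _ _ _ _ _ => by simp)
    hcBlo hcAlo hcDAlo hα3 hα4 hsmall hc₃ hsc hα₃' hs₁ hs₂ hs₃ hs₄ hs₅ hs₆ hs₇ hsm hprod8 hE_def hE₂_def lE_def lE₂_def hcA' ha₁' hb₁' hθ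
    h103 h106
  obtain ⟨lam, hlamP, hsa, hoff, -, h108, hmult, h129'⟩ := hbody
  subst hα₄_def
  exact sP5_step_of_HFP_per hd2 hη L m hU₀ hα84 (hcs_def ▸ hcs12) Ω Λs u₁ U₁ A (hcs_def ▸ hdat)
    ⟨lam, hlamP, hsa, hoff, h108, hmult, h129'⟩

end Step

/-! ## §3 T5's `SP5base` ∃-clause at ONE member and ONE periodic pair, from the nested periodic base storey
(`B8SockHFPTraceFreePer.sockHFP₀_body_of_join_RD_traceFree_per` at `τ := 0`, `H := ⊤`, `G := U(𝔸)`) -/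

section Base

variable {𝔸 : Type*} [CStarAlgebra 𝔸] [Nontrivial 𝔸]

/-- ★★ **PROPOSITION 5, EXISTENCE (1.107)–(1.108) AT LEVEL `1` FROM THE DATUM `u₁ = 1`, `U₁ = U′` (p. 89 «They are satisfied in the case k = 1 also, if we
take u₁ = 1, U′ = U₁»), NESTED PERIODIC DOMAINS — THE ∃-CLAUSE OF pub-ymgap's GUARDED SOCKET `SP5base` (T5 :117–:130, `LanF := IsLandau138W`) AT ONE MEMBER
AND ONE PERIODIC UNITARY PAIR.**  For `d, L ≥ 2`, `k ≥ 1`, a member with nesting and towers at level `1`, a `P`-periodic unitary pair `(U₀, U′)` in Theorem 4's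
regime ((1.33), (1.34), all-truncation axial gauge) with the (1.66)₀ side clause `|U′ − 1| ≤ α₁` on the bonds of the plaquettes touching `Ω₀` (so, `B₁ = 5dLB₈`
being «not too small», `2 ≤ 5dLB₈`: `U′ = e^{iηA₀}` there with `A₀ = (iη)⁻¹ log U′` Hermitian PERIODIC, `|A₀| ≤ 2α₁η⁻¹ ≤ c⋆η⁻¹`), `Ω₀` periodic, the torus data
at level `1`, THE [4] LETTERS AT `(1, U₀)` WITH THEIR LAWS (module docstring) and the JOIN's scalar windows one-for-one at `α₄ = 8B₀′(5dLB₈)(α₀ + α₁)`: THERE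
ARE a unitary `P`-PERIODIC `v = e^{iλ}`, `= 1` off `Ω₀`, reading `e^{iλ}` on the bonds of the plaquettes touching `Ω_j` (`j ≤ 1`), with (1.108) graded at `α₄`,
the Landau condition of record (1.38) for `U′^{v⁻¹}` and (1.29) for `1·v` at one level — the ∃-clause of `SP5base` with `LanF := IsLandau138W`.  PROOF:
`sP5base_of_HFP_per` on the base storey (J-SU collapsed to `U(𝔸)`, `τ := 0`) at the datum `A₀`.
[cite: Balaban1985RegularSpaces, Prop. 5 (1.107)–(1.108) p.94, p.89, (1.66) p.88, Thm 4 p.88, (1.86)–(1.88) p.91, (1.38) p.82, (1.29) p.81, p.77 («Ω_j ⊂ T_η»); Balaban1985BackgroundPropagators, Thm 3.1 p.397, (3.19) p.393; Balaban1985Averaging, Prop. 10, (213) p.48] -/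
theorem sP5base_body_of_join_per (hd2 : 2 ≤ d) {L : ℕ} (hL : 2 ≤ L) {η : ℝ} (hη : 0 < η) (P : ℕ) {k : ℕ} (hk : 1 ≤ k)
    -- the member's geometry
    {Ω : ℕ → Set (Site d)} (hΩ : ∀ j, Ω (j + 1) ⊆ Ω j) {Λs : ℕ → ℕ → Set (Site d)}
    (htower : ∀ j, j ≤ 1 → ∀ y ∈ Λs 1 j, ∀ x, InBox (tlo L y j) (thi L y j) x → x ∈ Ω j)
    -- the socket's antecedents: constants (`B₁ := 5dL·B₈` «not too small», p. 89: `2 ≤ 5dLB₈`), (1.33), (1.34), the (1.66)₀ side clause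
    {α₀ α₁ B₈ B₀' cs α₄ : ℝ} (hα₀ : 0 < α₀) (hα₁ : 0 < α₁) (hB₈ : 0 < B₈) (hB₀' : 0 < B₀') (hB : 2 ≤ 5 * (d : ℝ) * L * B₈)
    (hcs_def : cs = 5 * (d : ℝ) * L * B₈ * (α₀ + α₁)) (hα₄_def : α₄ = 8 * B₀' * (5 * (d : ℝ) * L * B₈) * (α₀ + α₁))
    {U₀ U' : Site d → Fin d → 𝔸ˣ} (hU₀ : ∀ x κ, U₀ x κ ∈ unitaryUnits 𝔸) (hU' : ∀ x κ, U' x κ ∈ unitaryUnits 𝔸)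
    (hU₀p : IsPeriodic P U₀) (hU'p : IsPeriodic P U')
    (h33 : InAk L k η α₀ Ω U₀) (h34 : InAk L k η α₀ Ω (mulCfg U' U₀)) (hAx : ∀ m', m' ≤ k → InAx L m' (Λs m') U₀ (mulCfg U' U₀))
    (h66 : ∀ b ∈ {b : Site d × Fin d | SideTouches (Ω 0) b.1 b.2}, ‖((U' b.1 b.2 : 𝔸ˣ) : 𝔸) - 1‖ ≤ α₁)
    -- the [4] LETTERS at `(1, U₀)`, displayed as the JOIN reads them
    (g Δ : (Site d → 𝔸) →ₗ[ℂ] (Site d → 𝔸)) (q : (Site d → 𝔸) →ₗ[ℂ] (ℕ → Site d → 𝔸)) (qs : (ℕ → Site d → 𝔸) →ₗ[ℂ] (Site d → 𝔸))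
    (Aw c : (ℕ → Site d → 𝔸) →ₗ[ℂ] (ℕ → Site d → 𝔸))
    (g_rightΩ : ∀ x, (∀ (z : Site d) (i : Fin d), x (z + (P : ℤ) • e i) = x z) → ∀ y ∈ Ω 0, (Δ (g x) + qs (Aw (q (g x)))) y = x y)
    (c_range : ∀ f, (∀ (z : Site d) (i : Fin d), f (z + (P : ℤ) • e i) = f z) → q (g (g (qs (c (q f))))) = q f)
    -- the torus: every `Lʲ ∣ P`, shift-invariant `Λ_j`, periodic `Ω₀`; periodicity-preserving `G′`, `Q′ᵀCQ′` ((P) laws)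
    (hdiv : ∀ j, j ≤ 1 → ((L : ℤ) ^ j ∣ (P : ℤ)))
    (hΛ : ∀ j, j ≤ 1 → ∀ (y : Site d) (i : Fin d), y + ((P : ℤ) / (L : ℤ) ^ j) • e i ∈ Λs 1 j ↔ y ∈ Λs 1 j)
    (hΩp : IsPeriodic P (fun x : Site d => x ∈ Ω 0))
    (hGper : ∀ (f : Site d → 𝔸) (z : Site d) (i : Fin d), g f (z + (P : ℤ) • e i) = g f z)
    (hqcq_per : ∀ f : Site d → 𝔸, (∀ (z : Site d) (i : Fin d), f (z + (P : ℤ) • e i) = f z) →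
      ∀ (z : Site d) (i : Fin d), qs (c (q f)) (z + (P : ℤ) • e i) = qs (c (q f)) z)
    (hΔ : ∀ (f : Site d → 𝔸), ∀ x ∈ Ω 0, Δ f x = covLap η U₀ ((Ω 0).indicator f) x)
    (hqs : ∀ (μ : ℕ → Site d → 𝔸), ∀ x ∈ Ω 0, qs μ x = QT L 1 (Λs 1) U₀ μ x)
    (hq : ∀ (f : Site d → 𝔸) (j : ℕ), j ≤ 1 → ∀ y ∈ Λs 1 j, q f j y = QprimeIter (zdBlocking d L) (bgT L U₀) j f y)
    (H' : XSpace d 1 𝔸 →ₗ[ℂ] (Site d → 𝔸)) {B₀'H B₂' BG BR : ℝ} (hB₀'H : 0 < B₀'H) (hB₂' : 0 ≤ B₂') (hBG : 0 ≤ BG) (hBR : 0 ≤ BR)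
    (hH0 : ∀ (X : XSpace d 1 𝔸) (x : Site d), ‖H' X x‖ ≤ B₀'H * ‖X‖)
    (hH1 : ∀ j, j ≤ 1 → ∀ (X : XSpace d 1 𝔸), ∀ p ∈ {b : Site d × Fin d | SideTouches (Ω j) b.1 b.2},
      wt L η j * ‖covDerivFwd η U₀ p.2 (H' X) p.1‖ ≤ B₀'H * ‖X‖)
    (hH2 : ∀ X : XSpace d 1 𝔸, Bd2 L η 1 Ω (covLap η U₀ (H' X)) (B₂' * ‖X‖))
    (hHsupp : ∀ (X : XSpace d 1 𝔸) (x : Site d), x ∉ Ω 0 → H' X x = 0)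
    (hHequiv : ∀ X Y : XSpace d 1 𝔸, (∀ p, Y p = -star (X p)) → ∀ x, H' Y x = -star (H' X x))
    (hHper : ∀ X : XSpace d 1 𝔸, (∀ (p : Fin (1 + 1) × Site d) (i : Fin d), X (p.1, p.2 + ((P : ℤ) / (L : ℤ) ^ (p.1 : ℕ)) • e i) = X p) →
      ∀ (z : Site d) (i : Fin d), H' X (z + (P : ℤ) • e i) = H' X z)
    (hQH : ∀ (Y : XSpace d 1 𝔸), (∀ (p : Fin (1 + 1) × Site d) (i : Fin d), Y (p.1, p.2 + ((P : ℤ) / (L : ℤ) ^ (p.1 : ℕ)) • e i) = Y p) →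
      ∀ (j : ℕ) (hj : j ≤ 1) (y : Site d), y ∈ Λs 1 j →
      QprimeIter (zdBlocking d L) (bgT L U₀) j (H' Y) y = Y (⟨j, Nat.lt_succ_of_le hj⟩, y))
    (hG : ∀ (f : Site d → 𝔸) (r : ℝ), 0 ≤ r → Bd2 L η 1 Ω f r →
      (∀ x, ‖g f x‖ ≤ BG * r) ∧ ∀ j, j ≤ 1 → ∀ p ∈ {b : Site d × Fin d | SideTouches (Ω j) b.1 b.2},
        wt L η j * ‖covDerivFwd η U₀ p.2 (g f) p.1‖ ≤ BG * r)
    (hGsupp : ∀ (f : Site d → 𝔸) (x : Site d), x ∉ Ω 0 → g f x = 0)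
    (hGreal : ∀ f : Site d → 𝔸, (∀ j, j ≤ 1 → ∀ x ∈ Ω j, IsSelfAdjoint (f x)) → ∀ x, IsSelfAdjoint (g f x))
    (hRbd : ∀ (f : Site d → 𝔸) (r : ℝ), 0 ≤ r → Bd2 L η 1 Ω f r → Bd2 L η 1 Ω (f - g (qs (c (q (g f))))) (BR * r))
    (hRreal : ∀ f : Site d → 𝔸, (∀ j, j ≤ 1 → ∀ x ∈ Ω j, IsSelfAdjoint (f x)) →
      ∀ j, j ≤ 1 → ∀ x ∈ Ω j, IsSelfAdjoint ((f - g (qs (c (q (g f))))) x))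
    -- the JOIN's scalar windows, one-for-one (`αP := α₀`, `α₄ := 8B₀′c⋆`; `cB cA cDA` free above their datum values, `cDA ≥ 2dL²c⋆` here)
    {cB cA cDA : ℝ} (hcBlo : L * cs ≤ cB) (hcAlo : L * cs ≤ cA) (hcDAlo : 2 * (d : ℝ) * (L : ℝ) ^ 2 * cs ≤ cDA)
    (hα3 : C0 d * α₀ ≤ 1 / 3) (hα4 : 4 * α₀ ≤ c2' d L)
    (hsmall : Real.exp (4 * (800 * ((d : ℝ) + 1) ^ 2 * ((d : ℝ) + 4)) * α₀) * (1 + 8 * (131072 * ((d : ℝ) + 1) ^ 2) * cB) ≤ 2)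
    (hc₃ : 2 * cB ≤ c3 d L) (hsc : 2048 * (d : ℝ) * cB ≤ 1) (hα₃' : 40 * d * cB ≤ 1 / 200)
    (hs₁ : 200 * C6 d * (2 * α₄) ≤ 1) (hs₂ : 12000 * ((d : ℝ) + 1) * L * (2 * α₄) ≤ 1)
    (hs₃ : C4G d L * (α₀ + 40 * d * cB + 4 * (2 * α₄)) ≤ 1)
    (hs₄ : 1024 * ((d : ℝ) + 1) * ((d : ℝ) + 4) * L ^ 2 * α₀ ≤ 1) (hs₅ : 32 * ((d : ℝ) + 1) ^ 2 * C6 d * L ^ 2 * α₀ ≤ 1)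
    (hs₆ : 16 * d * C5' d * C6 d * (L : ℝ) ^ 2 * α₀ ≤ 1) (hs₇ : 8 * d * C6 d * L * α₀ ≤ 1)
    (hsm : 40 * d * cB + α₄ ≤ 1 / (4 * B₀'H * (2 * C2p d))) (hprod8 : 2 * C6 d * (40 * d * cB + 4 * α₄) ≤ 1 / 8)
    {hE hE₂ lE lE₂ : ℝ} (hE_def : hE = B₀'H * (C2p d * (40 * d * cB + α₄) * α₄)) (hE₂_def : hE₂ = B₂' * (C2p d * (40 * d * cB + α₄) * α₄))
    (lE_def : lE = B₀'H * (4 * C2p d * (40 * d * cB + 2 * α₄))) (lE₂_def : lE₂ = B₂' * (4 * C2p d * (40 * d * cB + 2 * α₄)))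
    (hcA' : cA ≤ 1 / 13) (ha₁' : α₄ / 4 + hE ≤ 1 / 24) (hb₁' : α₄ / 4 + hE ≤ 1 / 140) (hθ : 10 * (α₄ / 4 + hE) * BR ≤ 1 / 2)
    (h103 : BG * Mc d BR (α₄ / 4 + hE) cA hE₂ cDA ≤ α₄ / 4)
    (h106 : BG * Kc d BR (α₄ / 4 + hE) cA hE₂ cDA lE₂ (1 + lE) (1 + lE) ≤ 1 / 2) :
    ∃ (v : Site d → 𝔸ˣ) (lam : Site d → 𝔸), (∀ x, v x ∈ unitaryUnits 𝔸) ∧ (∀ x, x ∉ Ω 0 → v x = 1) ∧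
      (∀ j, j ≤ 1 → ∀ b ∈ {b : Site d × Fin d | SideTouches (Ω j) b.1 b.2}, (v b.1 : 𝔸) = ((gaugeExp lam b.1 : 𝔸ˣ) : 𝔸) ∧
        (v (b.1 + e b.2) : 𝔸) = ((gaugeExp lam (b.1 + e b.2) : 𝔸ˣ) : 𝔸)) ∧
      (∀ j, j ≤ 1 → ∀ b ∈ {b : Site d × Fin d | SideTouches (Ω j) b.1 b.2},
        ‖lam b.1‖ ≤ (8 * B₀' * (5 * (d : ℝ) * L * B₈) * (α₀ + α₁)) ∧
          ((L : ℝ) ^ j * η) * ‖covDerivFwd η U₀ b.2 lam b.1‖ ≤ (8 * B₀' * (5 * (d : ℝ) * L * B₈) * (α₀ + α₁))) ∧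
      IsLandau138W L 1 η (Ω 0) (Λs 1) U₀ (mgauge U₀ v⁻¹ U') ∧ Restr129 L 1 (Λs 1) U₀ ((1 : Site d → 𝔸ˣ) * v) ∧
      IsPeriodic P v := by
  -- the adapter's windows: `α₄ ≤ 1/84`, `c⋆ ≤ 1/12`, and `2α₁ ≤ c⋆`, `α₁ ≤ 1/4` from `2 ≤ 5dLB₈`
  have hsum : 0 ≤ α₀ + α₁ := by linarith
  have hcs0 : 0 ≤ cs := by rw [hcs_def]; positivity
  have hα₄0 : 0 ≤ α₄ := by rw [hα₄_def]; positivity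
  have hC6 : (2 : ℝ) ≤ C6 d := by unfold C6; linarith [B7Prop10Flat.one_le_C5 (d := d)]
  have hα84 : α₄ ≤ 1 / 84 := by
    have h1 : 400 * (C6 d * α₄) ≤ 1 := by linarith only [hs₁]
    have h2 : 2 * α₄ ≤ C6 d * α₄ := mul_le_mul_of_nonneg_right hC6 hα₄0
    linarith only [h1, h2]
  have hd1 : (1 : ℝ) ≤ d := by exact_mod_cast (show 1 ≤ d by omega)
  have hL1 : (1 : ℝ) ≤ L := by exact_mod_cast (show 1 ≤ L by omega)
  have hcs12 : cs ≤ 1 / 12 := by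
    have h1 : cs ≤ L * cs := le_mul_of_one_le_left hcs0 hL1
    have h2 : L * cs ≤ cB := hcBlo
    have h3 : cB ≤ (d : ℝ) * cB := le_mul_of_one_le_left (hcs0.trans (h1.trans h2)) hd1
    have h4 : 40 * ((d : ℝ) * cB) ≤ 1 / 200 := by linarith only [hα₃']
    linarith only [h1, h2, h3, h4]
  have ha2 : 2 * α₁ ≤ cs := by
    have h1 : 2 * (α₀ + α₁) ≤ 5 * (d : ℝ) * L * B₈ * (α₀ + α₁) := mul_le_mul_of_nonneg_right hB hsum
    rw [hcs_def]; linarith only [h1, hα₀.le]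
  have ha : α₁ ≤ 1 / 4 := by linarith only [ha2, hcs12]
  have hΩper : ∀ j, j ≤ 0 → ∀ (x : Site d) (κ : Fin d) (i : Fin d),
      SideTouches (Ω j) (x + (P : ℤ) • e i) κ ↔ SideTouches (Ω j) x κ := fun j hj x κ i => by
    obtain rfl : j = 0 := Nat.le_zero.mp hj
    exact sideTouches_add_zsmul_iff hΩp x (e i) κ
  subst hα₄_def
  refine sP5base_of_HFP_per hd2 hη L hU₀ hU' (per_dir_of_isPeriodic hU'p) hα84 hcs12 ha ha2 Ω Λs h66 fun A hAper hdat => ?_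
  obtain ⟨lam, hlamP, hsa, hoff, -, h108, hmult, h129'⟩ :=
    sockHFP₀_body_of_join_RD_traceFree_per (0 : 𝔸 →L[ℂ] ℂ) (fun _ _ => by simp) hd2 hL hη (P : ℤ) hk
      (G := unitaryUnits 𝔸) (H := ⊤) (fun _ _ _ => by simp) (fun _ _ => Subgroup.mem_top _) (avgClosed_unitaryUnits d L) le_top le_rfl
      hΩ htower hα₀ hα₁ hB₈ hB₀' hcs_def rfl hU₀ h33 h34 hAx hdat (fun _ _ _ _ => by simp)
      g Δ q qs Aw c g_rightΩ c_range hdiv hΛ hΩper (per_dir_of_isPeriodic hU₀p) hAper hGper hqcq_per hΔ hqs hq H' hB₀'H hB₂' hBG hBR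
      hH0 hH1 hH2 hHsupp hHequiv hHper hQH hG hGsupp hGreal hRbd hRreal
      (fun _ _ _ => by simp) (fun _ _ _ => by simp) (fun _ _ _ _ _ _ => by simp)
      hcBlo hcAlo hcDAlo hα3 hα4 hsmall hc₃ hsc hα₃' hs₁ hs₂ hs₃ hs₄ hs₅ hs₆ hs₇ hsm hprod8 hE_def hE₂_def lE_def lE₂_def hcA' ha₁' hb₁' hθ
      h103 h106
  exact ⟨lam, hlamP, hsa, hoff, h108, hmult, h129'⟩

end Base

#print axioms sP5_step_of_HFP_per
#print axioms sP5base_of_HFP_per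
#print axioms sP5_body_of_join_per
#print axioms sP5base_body_of_join_per



end Literature.MathematicalPhysics.QuantumFieldTheory.Balaban1983to89.B8Prop5NestedServerPerBody

end
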